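import Mathlib
import Literature.NumberTheory.LFunctions.Zhang2022.Section15CEq1522Reduced
import Literature.NumberTheory.LFunctions.Zhang2022.AppendixBLemma151ReductionLemmas
import Literature.NumberTheory.LFunctions.MertensElementary
import HarnessLib

/-!
# Zhang (2022) §15 pp. 85–87: the multiplicative majorant of `ϖ₁ⱼ` over the `𝒬`-smooth numbers —
# the smooth-sum input of (15.22), discharged (and the Euler-product engine of the Rankin cut)

Topic `Literature/NumberTheory/LFunctions/Zhang2022` (Landau–Siegel audit tree; verdict-neutral).
Y. Zhang, *Discrete mean estimates and the Landau–Siegel zero*, arXiv:2211.02515v1 (2022)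
[Zhang2022LandauSiegel] — **an unrefereed manuscript under adjudication; nothing here asserts or denies
its Theorems 1–2.** ZHANG-L discharge lane (WP15), leaf
`h15_22 : Typed.Section15C.Eq15_22 c′ Typed.Section15C.inputs15ABchi` (DAG node `Z22:(15.22)`
[Z22 §15 p. 87, tex L4306]); the two size inputs of the deduction «By (15.19)–(15.21) and Lemma 15.1»
that the manuscript leaves implicit (p. 86, tex L4252–L4258: "Every `n` can be uniquely written as
`n = n₁n₂` … Using the Rankin trick (see [14, Section 13.2], for example), we can impose the constraint
`n₁ < T` to the right side above with an acceptable error `O(ε₁)`"):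

* `norm_varpi1_le_majorant` — **`|ϖ₁ⱼ(n)| ≤ K·τ₂(n)·∏_{q∣n}(1 + 8/q)(1 + c q^{−9/10})`** for all large `D`
  under (A) (`1 ≤ j ≤ 3`, `n ≥ 1`), from the definition `ϖ₁ⱼ(n) = Σ_{n=dl} λ₁(d)d^{βⱼ}χ(l)𝓜₁(d,l;1−βⱼ)
  /𝓜₁(1,1;1−βⱼ)`, §15.u035 (`Typed.Section15B.step15_u035_holds`: `𝓜₁(d,l;s) ≪ ∏_{q∣dl}(1+cq^{−9/10})`),
  `‖𝓜₁(1,1;1−βⱼ)‖ ≥ 1/2` (`Typed.Section15B.norm_calM1_one_one_betaJ_ge`, Lemma 15.2) and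
  `|λ₁(q)| ≤ 1 + 8/q` (`norm_lam1_prime_one_sub_one_le`);
* `sum_le_prod_tsum_of_multiplicative` — a finite sum of a non-negative multiplicative function over
  `s`-factored numbers is at most its Euler product over `s` (Mathlib
  `EulerProduct.summable_and_hasSum_factoredNumbers_prod_filter_prime_tsum`);
* `sum_majorant_rpow_le_prod` — for `0 ≤ δ ≤ 1/2`: `Σ_{n∈A} τ₂(n)²∏_{q∣n}w(q)·n^{δ−1} ≤
  ∏_{p<D⁴}(1 + 4w(p)p^{δ−1}/(1 − p^{δ−1})³)` for finite `A ⊆ 𝒩(𝒬)` (local series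
  `Σ_{e≥1}(e+1)²xᵉ ≤ 4x/(1−x)³`, Mathlib `hasSum_choose_mul_geometric_of_norm_lt_one`);
* `smooth_majorant_holds` — **`Σ_{n∈𝒩(𝒬), n<T} τ₂(n)|ϖ₁ⱼ(n)|/n ≤ C𝓛⁶`** (in fact `≪ 𝓛⁴`: `δ = 0`,
  `Σ_{p<D⁴}4/p ≤ 4 log log D⁴ + 16` by Mertens, tree `MertensBound.sum_inv_prime_le`) — the hypothesis
  `hS` of `Typed.Section15C.calS1_eval_of_parts`;
* `prod_local_factor_le_exp` — the same product for a general exponent `a ≤ −1/2` with `pᵃ ≤ B/p`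
  (`≤ exp(1280(1+c)B(log(4𝓛)+4))`), the input of the Rankin cut `n₁ < T` (sibling file
  `Section15CRankin`, `δ = 1/(4𝓛)`).

WHAT THIS IS NOT: a proof of the Rankin cut or of Lemma 15.1 (Appendix B; WP15-PLAN legs B1–B5), nor
any claim about Theorems 1–2 of the manuscript or Landau–Siegel zeros.

## References
* Y. Zhang, arXiv:2211.02515v1 (2022), §15 pp. 85–87. [cite: Zhang2022LandauSiegel, §15 (15.22) p.87]
* H. Iwaniec, E. Kowalski, *Analytic Number Theory* (2004), §13.2 (Rankin's trick). [cite: IwaniecKowalski2004, §13.2]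
-/

noncomputable section

open Complex Real ComplexConjugate Finset
open Literature.NumberTheory.LFunctions.Zhang2022.Skeleton
open Literature.NumberTheory.LFunctions.Zhang2022.Typed

namespace Literature.NumberTheory.LFunctions.Zhang2022.Typed.Section15C

/-! ## 1. Finite sums of a non-negative multiplicative function over factored numbers -/

section EulerMajorant

/-- **A finite sum of a non-negative multiplicative `F` over `s`-factored numbers is at most the Euler
product `∏_{p∈s} Σ_e F(pᵉ)`** (Mathlib's `HasSum` over `Nat.factoredNumbers s`, restricted to a finite
subset) — the Euler-product majorant step behind "Σ_{n∈𝒩(𝒬)} … ≪ ∏_{q<D⁴}(…)".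
[cite: IwaniecKowalski2004, §1.3] -/
theorem sum_le_prod_tsum_of_multiplicative {F : ℕ → ℝ} (hF1 : F 1 = 1)
    (hmul : ∀ {m n : ℕ}, Nat.Coprime m n → F (m * n) = F m * F n) (hnn : ∀ n, 0 ≤ F n)
    (hsum : ∀ {p : ℕ}, p.Prime → Summable (fun e : ℕ => F (p ^ e)))
    (s : Finset ℕ) (A : Finset ℕ) (hA : ∀ n ∈ A, n ∈ Nat.factoredNumbers s) :
    ∑ n ∈ A, F n ≤ ∏ p ∈ s with p.Prime, ∑' e : ℕ, F (p ^ e) := by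
  have h := (EulerProduct.summable_and_hasSum_factoredNumbers_prod_filter_prime_tsum hF1 hmul
    (fun hp => by simpa [Real.norm_eq_abs, abs_of_nonneg (hnn _)] using hsum hp) s).2
  have hsub : ∑ x ∈ A.subtype (· ∈ Nat.factoredNumbers s), F (x : ℕ) = ∑ n ∈ A, F n :=
    Finset.sum_subtype_of_mem (f := fun n => F n) hA
  rw [← hsub]
  exact sum_le_hasSum _ (fun x _ => hnn x) h

/-- The local series `Σ_{e≥1}(e+1)²xᵉ ≤ 4x/(1−x)³` for `0 ≤ x < 1`, in the form used below: the
sequence `e ↦ [e=0] + (e+1)²·w·xᵉ·[e≥1]` is summable with sum `≤ 1 + 4wx/(1−x)³` (termwise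
`(e+1)² ≤ 4·C(e+1,2)` for `e ≥ 1` and `Σ_e C(e+1,2)xᵉ = x/(1−x)³`). [folklore] -/
private theorem summable_local_and_tsum_le {w x : ℝ} (hw : 0 ≤ w) (hx0 : 0 ≤ x) (hx1 : x < 1) :
    Summable (fun e : ℕ => if e = 0 then (1 : ℝ) else ((e : ℝ) + 1) ^ 2 * w * x ^ e) ∧
      ∑' e : ℕ, (if e = 0 then (1 : ℝ) else ((e : ℝ) + 1) ^ 2 * w * x ^ e) ≤
        1 + 4 * w * x / (1 - x) ^ 3 := by
  have hxn : ‖x‖ < 1 := by rw [Real.norm_eq_abs, abs_of_nonneg hx0]; exact hx1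
  -- `Σ_m C(m+2,2) x^m = 1/(1-x)^3`, shifted: `Σ_e C(e+1,2) x^e = x/(1-x)^3`
  have h2 := hasSum_choose_mul_geometric_of_norm_lt_one 2 hxn
  have hshift : HasSum (fun e : ℕ => (((e + 1).choose 2 : ℕ) : ℝ) * x ^ e) (x * (1 / (1 - x) ^ 3)) := by
    have h3 : HasSum (fun m : ℕ => (((m + 1 + 1).choose 2 : ℕ) : ℝ) * x ^ (m + 1))
        (x * (1 / (1 - x) ^ 3)) := by
      have h3' : HasSum (fun m : ℕ => x * ((((m + 2).choose 2 : ℕ) : ℝ) * x ^ m))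
          (x * (1 / (1 - x) ^ 3)) := by
        have := h2.mul_left x
        norm_num at this ⊢
        exact this
      refine h3'.congr_fun fun m => ?_
      rw [pow_succ]; ring_nf
    have h4 := (hasSum_nat_add_iff (f := fun e : ℕ => (((e + 1).choose 2 : ℕ) : ℝ) * x ^ e) 1).mp h3
    simpa using h4
  -- the dominating summable sequence
  set H : ℕ → ℝ := fun e => (if e = 0 then (1 : ℝ) else 0) + 4 * w * ((((e + 1).choose 2 : ℕ) : ℝ) * x ^ e)
    with hH
  have hHsum : HasSum H (1 + 4 * w * (x * (1 / (1 - x) ^ 3))) := by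
    have h0 : HasSum (fun e : ℕ => if e = 0 then (1 : ℝ) else 0) 1 := by
      convert hasSum_ite_eq 0 (1 : ℝ) using 1
    exact h0.add (hshift.mul_left (4 * w))
  set G : ℕ → ℝ := fun e => if e = 0 then (1 : ℝ) else ((e : ℝ) + 1) ^ 2 * w * x ^ e with hG
  have hGH : ∀ e, G e ≤ H e := by
    intro e
    simp only [hG, hH]
    split_ifs with he
    · subst he; simp
    · have he1 : 1 ≤ e := Nat.one_le_iff_ne_zero.mpr he
      have hc : ((e : ℝ) + 1) ^ 2 ≤ 4 * (((e + 1).choose 2 : ℕ) : ℝ) := by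
        rw [Nat.cast_choose_two]
        push_cast
        have he' : (1 : ℝ) ≤ e := by exact_mod_cast he1
        nlinarith
      have hxe : 0 ≤ x ^ e := pow_nonneg hx0 e
      nlinarith [mul_nonneg hw hxe]
  have hGnn : ∀ e, 0 ≤ G e := by
    intro e; simp only [hG]; split_ifs
    · norm_num
    · positivity
  have hGsum : Summable G := Summable.of_nonneg_of_le hGnn hGH hHsum.summable
  refine ⟨hGsum, ?_⟩
  calc ∑' e, G e ≤ ∑' e, H e := hGsum.tsum_le_tsum hGH hHsum.summable
    _ = 1 + 4 * w * (x * (1 / (1 - x) ^ 3)) := hHsum.tsum_eq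
    _ = 1 + 4 * w * x / (1 - x) ^ 3 := by ring

end EulerMajorant

/-! ## 2. The multiplicative majorant `F_δ(n) = τ₂(n)²·∏_{q∣n} w(q)·n^{δ−1}` and its Euler product -/

section Majorant

/-- `τ₂(pᵏ) = k + 1`. [folklore] -/
private theorem card_divisors_prime_pow' {p : ℕ} (hp : p.Prime) (k : ℕ) :
    (p ^ k).divisors.card = k + 1 := by
  rw [← ArithmeticFunction.sigma_zero_apply, ArithmeticFunction.sigma_zero_apply_prime_pow hp]

/-- **Multiplicativity of the majorant**: for a weight `w : ℕ → ℝ` and an exponent `a : ℝ`, the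
function `F(n) = τ₂(n)²(∏_{q∣n} w(q))·n^a` satisfies `F(1) = 1` and `F(mn) = F(m)F(n)` for coprime
`m, n`. [folklore] -/
private theorem majorant_one_and_mul (w : ℕ → ℝ) (a : ℝ) :
    (fun n : ℕ => ((n.divisors.card : ℝ)) ^ 2 * (∏ q ∈ n.primeFactors, w q) * (n : ℝ) ^ a) 1 = 1 ∧
    ∀ {m n : ℕ}, Nat.Coprime m n →
      (fun n : ℕ => ((n.divisors.card : ℝ)) ^ 2 * (∏ q ∈ n.primeFactors, w q) * (n : ℝ) ^ a) (m * n) =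
        (fun n : ℕ => ((n.divisors.card : ℝ)) ^ 2 * (∏ q ∈ n.primeFactors, w q) * (n : ℝ) ^ a) m *
          (fun n : ℕ => ((n.divisors.card : ℝ)) ^ 2 * (∏ q ∈ n.primeFactors, w q) * (n : ℝ) ^ a) n := by
  constructor
  · simp
  · intro m n hmn
    simp only
    rw [Nat.Coprime.card_divisors_mul hmn, Nat.Coprime.primeFactors_mul hmn,
      Finset.prod_union hmn.disjoint_primeFactors, Nat.cast_mul, Nat.cast_mul,
      Real.mul_rpow (Nat.cast_nonneg m) (Nat.cast_nonneg n)]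
    ring

/-- The majorant at a prime power `pᵉ`, `e ≥ 1`: `F(pᵉ) = (e+1)²·w(p)·(pᵃ)ᵉ`. [folklore] -/
private theorem majorant_prime_pow (w : ℕ → ℝ) (a : ℝ) {p : ℕ} (hp : p.Prime) {e : ℕ} (he : e ≠ 0) :
    (fun n : ℕ => ((n.divisors.card : ℝ)) ^ 2 * (∏ q ∈ n.primeFactors, w q) * (n : ℝ) ^ a) (p ^ e) =
      ((e : ℝ) + 1) ^ 2 * w p * ((p : ℝ) ^ a) ^ e := by
  simp only
  rw [card_divisors_prime_pow' hp, Nat.primeFactors_prime_pow he hp, Finset.prod_singleton,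
    Nat.cast_pow, ← Real.rpow_natCast ((p : ℝ) ^ a), ← Real.rpow_mul (Nat.cast_nonneg p),
    mul_comm a, Real.rpow_mul (Nat.cast_nonneg p), Real.rpow_natCast]
  push_cast
  ring

/-- **The Euler-product bound for the majorant.** For a non-negative weight `w`, an exponent
`a ≤ −1/2` and a finite set `A` of `s`-factored numbers (`s` a set of primes):
`Σ_{n∈A} τ₂(n)²(∏_{q∣n}w(q))nᵃ ≤ ∏_{p∈s}(1 + 4w(p)pᵃ/(1 − pᵃ)³)` (every `pᵃ ≤ 2^{−1/2} < 1`) —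
Rankin's multiplicative majorant. [cite: IwaniecKowalski2004, §13.2] -/
theorem sum_majorant_le_prod {w : ℕ → ℝ} (hw : ∀ q, 0 ≤ w q) {a : ℝ} (ha : a ≤ -(1 / 2 : ℝ))
    (s : Finset ℕ) (hs : ∀ p ∈ s, p.Prime) (A : Finset ℕ) (hA : ∀ n ∈ A, n ∈ Nat.factoredNumbers s) :
    ∑ n ∈ A, ((n.divisors.card : ℝ)) ^ 2 * (∏ q ∈ n.primeFactors, w q) * (n : ℝ) ^ a ≤
      ∏ p ∈ s, (1 + 4 * w p * (p : ℝ) ^ a / (1 - (p : ℝ) ^ a) ^ 3) := by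
  set F : ℕ → ℝ := fun n => ((n.divisors.card : ℝ)) ^ 2 * (∏ q ∈ n.primeFactors, w q) * (n : ℝ) ^ a
    with hF
  obtain ⟨hF1, hmul⟩ := majorant_one_and_mul w a
  have hnn : ∀ n, 0 ≤ F n := fun n => by
    simp only [hF]
    exact mul_nonneg (mul_nonneg (sq_nonneg _) (Finset.prod_nonneg fun q _ => hw q))
      (Real.rpow_nonneg (Nat.cast_nonneg n) _)
  -- the local data at a prime `p`: `x = pᵃ ∈ [0, 2^{-1/2}]`
  have hx : ∀ {p : ℕ}, p.Prime → 0 ≤ (p : ℝ) ^ a ∧ (p : ℝ) ^ a < 1 := by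
    intro p hp
    have hp2 : (2 : ℝ) ≤ p := by exact_mod_cast hp.two_le
    refine ⟨Real.rpow_nonneg (by linarith) _, ?_⟩
    calc (p : ℝ) ^ a ≤ (p : ℝ) ^ (-(1 / 2 : ℝ)) := Real.rpow_le_rpow_of_exponent_le (by linarith) ha
      _ < 1 := Real.rpow_lt_one_of_one_lt_of_neg (by linarith) (by norm_num)
  -- the local series of `F` at `p` is the sequence of `summable_local_and_tsum_le`
  have hloc : ∀ {p : ℕ}, p.Prime → (fun e : ℕ => F (p ^ e)) =
      fun e : ℕ => if e = 0 then (1 : ℝ) else ((e : ℝ) + 1) ^ 2 * w p * ((p : ℝ) ^ a) ^ e := by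
    intro p hp
    funext e
    split_ifs with he
    · rw [he, pow_zero]; exact hF1
    · exact majorant_prime_pow w a hp he
  have hsum : ∀ {p : ℕ}, p.Prime → Summable (fun e : ℕ => F (p ^ e)) := by
    intro p hp
    rw [hloc hp]
    exact (summable_local_and_tsum_le (hw p) (hx hp).1 (hx hp).2).1
  have h1 := sum_le_prod_tsum_of_multiplicative hF1 hmul hnn hsum s A hA
  have hfilt : s.filter Nat.Prime = s := Finset.filter_true_of_mem hs
  rw [hfilt] at h1
  refine h1.trans (Finset.prod_le_prod (fun p hp => tsum_nonneg fun e => hnn _) fun p hp => ?_)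
  rw [hloc (hs p hp)]
  exact (summable_local_and_tsum_le (hw p) (hx (hs p hp)).1 (hx (hs p hp)).2).2

/-- `∏_{p∈s}(1 + u_p) ≤ exp(Σ_{p∈s} u_p)` for `u_p ≥ 0`. [folklore] -/
private theorem prod_one_add_le_exp_sum {ι : Type*} (s : Finset ι) (u : ι → ℝ) (hu : ∀ i ∈ s, 0 ≤ u i) :
    ∏ i ∈ s, (1 + u i) ≤ Real.exp (∑ i ∈ s, u i) := by
  rw [Real.exp_sum]
  exact Finset.prod_le_prod (fun i hi => by linarith [hu i hi]) fun i hi => by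
    have := Real.add_one_le_exp (u i); linarith

end Majorant

/-! ## 3. Evaluating the Euler product over the primes `p < D⁴` (Mertens) -/

section Evaluation

/-- `𝒩(𝒬) ⊆` the `primesBelow(D⁴)`-factored numbers (`𝒬 = ∏_{q<D⁴} q`).
[cite: Zhang2022LandauSiegel, §15 (15.20) p.86] -/
theorem mem_factoredNumbers_of_mem_nset_frakq {D n : ℕ} (hn : n ∈ nset (frakq D)) :
    n ∈ Nat.factoredNumbers (Nat.primesBelow (D ^ 4)) := by
  rw [Nat.mem_factoredNumbers']
  intro p hp hpn
  rw [Nat.mem_primesBelow]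
  exact ⟨(Section15B.prime_dvd_frakq_iff hp).mp (hn.2 p hp hpn), hp⟩

/-- **Mertens over the primes below `D⁴`**: `Σ_{p<D⁴} 1/p ≤ log(4𝓛) + 4` for `D ≥ 2` (tree
`MertensBound.sum_inv_prime_le`, `log log D⁴ = log(4 log D)`). [cite: HardyWright2008, Thm 427] -/
theorem sum_primesBelow_inv_le {D : ℕ} (hD : 2 ≤ D) :
    ∑ p ∈ Nat.primesBelow (D ^ 4), (1 : ℝ) / p ≤ Real.log (4 * ell D) + 4 := by
  have hD4 : 2 ≤ D ^ 4 := le_trans hD (Nat.le_self_pow (by norm_num) D)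
  have hsub : Nat.primesBelow (D ^ 4) ⊆ Nat.primesLE (D ^ 4) := by
    intro p hp
    rw [Nat.mem_primesBelow] at hp
    exact Nat.mem_primesLE.mpr ⟨hp.1.le, hp.2⟩
  have h := MertensBound.sum_inv_prime_le (D ^ 4) hD4
  have hlog : Real.log (Real.log ((D ^ 4 : ℕ) : ℝ)) = Real.log (4 * ell D) := by
    rw [Nat.cast_pow, Real.log_pow, ell]; norm_num
  calc ∑ p ∈ Nat.primesBelow (D ^ 4), (1 : ℝ) / p ≤ ∑ p ∈ Nat.primesLE (D ^ 4), (1 : ℝ) / p :=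
        Finset.sum_le_sum_of_subset_of_nonneg hsub fun p _ _ => by positivity
    _ ≤ Real.log (Real.log ((D ^ 4 : ℕ) : ℝ)) + 4 := h
    _ = Real.log (4 * ell D) + 4 := by rw [hlog]

/-- The weight of the majorant: `w_c(q) = (1 + 8/q)(1 + c·q^{−9/10})` (the local sizes `|λ₁(q)| ≤ 1 + 8/q`
and `𝓜₁ ≪ ∏(1 + cq^{−9/10})` of §15, (15.10) and §15.u035); for `c ≥ 0` and `q ≥ 2`: `0 ≤ w_c(q) ≤ 5(1 + c)`.
[cite: Zhang2022LandauSiegel, §15 p.84] -/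
theorem weight_nonneg_le {c : ℝ} (hc : 0 ≤ c) {q : ℕ} (hq : 2 ≤ q) :
    0 ≤ (1 + 8 / (q : ℝ)) * (1 + c * (q : ℝ) ^ (-(9 / 10 : ℝ))) ∧
      (1 + 8 / (q : ℝ)) * (1 + c * (q : ℝ) ^ (-(9 / 10 : ℝ))) ≤ 5 * (1 + c) := by
  have hq2 : (2 : ℝ) ≤ q := by exact_mod_cast hq
  have hq0 : (0 : ℝ) < q := by linarith
  have hr : 0 ≤ (q : ℝ) ^ (-(9 / 10 : ℝ)) := Real.rpow_nonneg hq0.le _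
  have hr1 : (q : ℝ) ^ (-(9 / 10 : ℝ)) ≤ 1 := Real.rpow_le_one_of_one_le_of_nonpos (by linarith) (by norm_num)
  have h8 : 8 / (q : ℝ) ≤ 4 := by rw [div_le_iff₀ hq0]; linarith
  refine ⟨by positivity, ?_⟩
  calc (1 + 8 / (q : ℝ)) * (1 + c * (q : ℝ) ^ (-(9 / 10 : ℝ))) ≤ (1 + 4) * (1 + c * 1) := by
        gcongr
    _ = 5 * (1 + c) := by ring

/-- **The local factor at `δ = 0`** (`x = 1/p ≤ 1/2`): `4w_c(p)x/(1−x)³ ≤ 4/p + 32(11 + 9c)·p^{−19/10}`.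
[folklore] -/
private theorem local_factor_zero_le {c : ℝ} (hc : 0 ≤ c) {p : ℕ} (hp : 2 ≤ p) :
    4 * ((1 + 8 / (p : ℝ)) * (1 + c * (p : ℝ) ^ (-(9 / 10 : ℝ)))) * (p : ℝ) ^ (-(1 : ℝ)) /
        (1 - (p : ℝ) ^ (-(1 : ℝ))) ^ 3 ≤
      4 / p + 32 * (11 + 9 * c) * (p : ℝ) ^ (-(19 / 10 : ℝ)) := by
  have hp2 : (2 : ℝ) ≤ p := by exact_mod_cast hp
  have hp0 : (0 : ℝ) < p := by linarith
  set x : ℝ := (p : ℝ) ^ (-(1 : ℝ)) with hx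
  have hx' : x = 1 / p := by rw [hx, Real.rpow_neg_one, one_div]
  have hx0 : 0 < x := by rw [hx']; positivity
  have hx2 : x ≤ 1 / 2 := by rw [hx', div_le_div_iff_of_pos_left one_pos hp0 (by norm_num)]; exact hp2
  have hx1 : x ≤ 1 := by linarith
  set y : ℝ := (p : ℝ) ^ (-(9 / 10 : ℝ)) with hy
  have hy0 : 0 ≤ y := Real.rpow_nonneg hp0.le _
  have hy1 : y ≤ 1 := Real.rpow_le_one_of_one_le_of_nonpos (by linarith) (by norm_num)
  -- `x ≤ y` (`p^{-1} ≤ p^{-9/10}`) and `x·y = p^{-19/10}`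
  have hxy : x ≤ y := Real.rpow_le_rpow_of_exponent_le (by linarith) (by norm_num)
  have hprod : x * y = (p : ℝ) ^ (-(19 / 10 : ℝ)) := by
    rw [hx, hy, ← Real.rpow_add hp0]; norm_num
  have h8p : 8 / (p : ℝ) = 8 * x := by rw [hx']; ring
  rw [h8p, show (4 : ℝ) / p = 4 * x by rw [hx']; ring, ← hprod]
  -- `(1-x)^3 ≥ 1/8` and `(1-x)^3 ≥ 1 - 3x`
  have hden : (1 / 8 : ℝ) ≤ (1 - x) ^ 3 := by
    have h : (1 / 2 : ℝ) ≤ 1 - x := by linarith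
    calc (1 / 8 : ℝ) = (1 / 2) ^ 3 := by norm_num
      _ ≤ (1 - x) ^ 3 := pow_le_pow_left₀ (by norm_num) h 3
  have hden' : 1 - 3 * x ≤ (1 - x) ^ 3 := by
    have h3 : 0 ≤ x ^ 2 * (3 - x) := mul_nonneg (sq_nonneg x) (by linarith)
    nlinarith
  have hdenpos : 0 < (1 - x) ^ 3 := by linarith
  rw [div_le_iff₀ hdenpos]
  -- `w - (1-x)^3 ≤ 11x + 9c y`
  have hw : (1 + 8 * x) * (1 + c * y) - (1 - x) ^ 3 ≤ 11 * x + 9 * c * y := by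
    have : (1 + 8 * x) * (1 + c * y) = 1 + 8 * x + c * y + 8 * c * (x * y) := by ring
    have hxy1 : x * y ≤ y := by nlinarith
    nlinarith [mul_nonneg hc hy0]
  -- conclude: `4wx ≤ (4x + 32(11+9c)xy)(1-x)^3`
  have hkey : 4 * ((1 + 8 * x) * (1 + c * y)) * x =
      4 * x * (1 - x) ^ 3 + 4 * x * ((1 + 8 * x) * (1 + c * y) - (1 - x) ^ 3) := by ring
  rw [hkey, add_mul]
  have h1 : 4 * x * ((1 + 8 * x) * (1 + c * y) - (1 - x) ^ 3) ≤ 4 * x * (11 * x + 9 * c * y) :=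
    mul_le_mul_of_nonneg_left hw (by positivity)
  have h2 : 4 * x * (11 * x + 9 * c * y) ≤ 32 * (11 + 9 * c) * (x * y) * (1 - x) ^ 3 := by
    -- `4x(11x + 9cy) ≤ 4(11+9c)xy ≤ 32(11+9c)xy(1-x)^3` using `x ≤ y` and `(1-x)^3 ≥ 1/8`
    have h3 : 4 * x * (11 * x + 9 * c * y) ≤ 4 * (11 + 9 * c) * (x * y) := by
      nlinarith [mul_nonneg hc hy0, mul_nonneg (mul_nonneg hc hy0) hx0.le]
    have h4 : 4 * (11 + 9 * c) * (x * y) ≤ 32 * (11 + 9 * c) * (x * y) * (1 - x) ^ 3 := by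
      have h5 : 0 ≤ (11 + 9 * c) * (x * y) := by positivity
      nlinarith
    linarith
  linarith

/-- **The Euler product at `δ = 0` is `≪ 𝓛⁴`**: for `c ≥ 0` and `D ≥ 2`,
`∏_{p<D⁴}(1 + 4w_c(p)p⁻¹/(1−p⁻¹)³) ≤ 256·exp(16 + 32(11+9c)·Z)·𝓛⁴`, `Z = Σ_n n^{−19/10}`.
[cite: Zhang2022LandauSiegel, §15 p.87] -/
theorem prod_local_factor_zero_le {c : ℝ} (hc : 0 ≤ c) {D : ℕ} (hD : 2 ≤ D) :
    ∏ p ∈ Nat.primesBelow (D ^ 4),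
        (1 + 4 * ((1 + 8 / (p : ℝ)) * (1 + c * (p : ℝ) ^ (-(9 / 10 : ℝ)))) * (p : ℝ) ^ (-(1 : ℝ)) /
          (1 - (p : ℝ) ^ (-(1 : ℝ))) ^ 3) ≤
      256 * Real.exp (16 + 32 * (11 + 9 * c) * ∑' n : ℕ, (n : ℝ) ^ (-(19 / 10 : ℝ))) * ell D ^ 4 := by
  set Z : ℝ := ∑' n : ℕ, (n : ℝ) ^ (-(19 / 10 : ℝ)) with hZ
  have hZsum : Summable (fun n : ℕ => (n : ℝ) ^ (-(19 / 10 : ℝ))) :=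
    Real.summable_nat_rpow.mpr (by norm_num)
  have hℓ0 : 0 < ell D := Real.log_pos (by exact_mod_cast (show 1 < D by omega))
  set u : ℕ → ℝ := fun p => 4 * ((1 + 8 / (p : ℝ)) * (1 + c * (p : ℝ) ^ (-(9 / 10 : ℝ)))) *
    (p : ℝ) ^ (-(1 : ℝ)) / (1 - (p : ℝ) ^ (-(1 : ℝ))) ^ 3 with hu
  have hprime : ∀ p ∈ Nat.primesBelow (D ^ 4), p.Prime := fun p hp => (Nat.mem_primesBelow.mp hp).2
  have hu0 : ∀ p ∈ Nat.primesBelow (D ^ 4), 0 ≤ u p := by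
    intro p hp
    have hp2 : (2 : ℝ) ≤ p := by exact_mod_cast (hprime p hp).two_le
    have hx1 : (p : ℝ) ^ (-(1 : ℝ)) < 1 :=
      Real.rpow_lt_one_of_one_lt_of_neg (by linarith) (by norm_num)
    have hx0 : 0 ≤ (p : ℝ) ^ (-(1 : ℝ)) := Real.rpow_nonneg (by linarith) _
    have hw := (weight_nonneg_le hc (hprime p hp).two_le).1
    simp only [hu]
    apply div_nonneg (by positivity)
    exact pow_nonneg (by linarith) 3
  have h1 : ∏ p ∈ Nat.primesBelow (D ^ 4), (1 + u p) ≤ Real.exp (∑ p ∈ Nat.primesBelow (D ^ 4), u p) :=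
    prod_one_add_le_exp_sum _ u hu0
  have h2 : ∑ p ∈ Nat.primesBelow (D ^ 4), u p ≤ 4 * (Real.log (4 * ell D) + 4) + 32 * (11 + 9 * c) * Z := by
    calc ∑ p ∈ Nat.primesBelow (D ^ 4), u p
        ≤ ∑ p ∈ Nat.primesBelow (D ^ 4), (4 / p + 32 * (11 + 9 * c) * (p : ℝ) ^ (-(19 / 10 : ℝ))) :=
          Finset.sum_le_sum fun p hp => local_factor_zero_le hc (hprime p hp).two_le
      _ = 4 * ∑ p ∈ Nat.primesBelow (D ^ 4), (1 : ℝ) / p +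
            32 * (11 + 9 * c) * ∑ p ∈ Nat.primesBelow (D ^ 4), (p : ℝ) ^ (-(19 / 10 : ℝ)) := by
          rw [Finset.sum_add_distrib, Finset.mul_sum, Finset.mul_sum]
          congr 1
          exact Finset.sum_congr rfl fun p _ => by ring
      _ ≤ 4 * (Real.log (4 * ell D) + 4) + 32 * (11 + 9 * c) * Z := by
          gcongr
          · exact sum_primesBelow_inv_le hD
          · exact hZsum.sum_le_tsum _ fun n _ => Real.rpow_nonneg (Nat.cast_nonneg n) _
  have h4ℓ : 0 < 4 * ell D := by linarith
  calc ∏ p ∈ Nat.primesBelow (D ^ 4), (1 + u p) ≤ Real.exp (∑ p ∈ Nat.primesBelow (D ^ 4), u p) := h1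
    _ ≤ Real.exp (4 * (Real.log (4 * ell D) + 4) + 32 * (11 + 9 * c) * Z) := Real.exp_le_exp.mpr h2
    _ = 256 * Real.exp (16 + 32 * (11 + 9 * c) * Z) * ell D ^ 4 := by
        have e1 : 4 * (Real.log (4 * ell D) + 4) + 32 * (11 + 9 * c) * Z =
            4 * Real.log (4 * ell D) + (16 + 32 * (11 + 9 * c) * Z) := by ring
        rw [e1, Real.exp_add, ← Real.log_rpow h4ℓ, Real.exp_log (Real.rpow_pos_of_pos h4ℓ _)]
        norm_num
        ring

/-- **The Euler product for a general exponent `a ∈ [−1, −1/2]` with `pᵃ ≤ B/p` on `p < D⁴`** (Rankin: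
`a = δ − 1`, `p^δ ≤ e`): `∏_{p<D⁴}(1 + 4w_c(p)pᵃ/(1−pᵃ)³) ≤ exp(M(log(4𝓛) + 4))`,
`M = 1280(1+c)·B`. [cite: IwaniecKowalski2004, §13.2] -/
theorem prod_local_factor_le_exp {c : ℝ} (hc : 0 ≤ c) {a B : ℝ} (ha : a ≤ -(1 / 2 : ℝ)) (hB : 0 ≤ B)
    {D : ℕ} (hD : 2 ≤ D) (hpow : ∀ p ∈ Nat.primesBelow (D ^ 4), (p : ℝ) ^ a ≤ B / p) :
    ∏ p ∈ Nat.primesBelow (D ^ 4),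
        (1 + 4 * ((1 + 8 / (p : ℝ)) * (1 + c * (p : ℝ) ^ (-(9 / 10 : ℝ)))) * (p : ℝ) ^ a /
          (1 - (p : ℝ) ^ a) ^ 3) ≤
      Real.exp (1280 * (1 + c) * B * (Real.log (4 * ell D) + 4)) := by
  set u : ℕ → ℝ := fun p => 4 * ((1 + 8 / (p : ℝ)) * (1 + c * (p : ℝ) ^ (-(9 / 10 : ℝ)))) *
    (p : ℝ) ^ a / (1 - (p : ℝ) ^ a) ^ 3 with hu
  have hprime : ∀ p ∈ Nat.primesBelow (D ^ 4), p.Prime := fun p hp => (Nat.mem_primesBelow.mp hp).2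
  -- `x ≤ 2^{-1/2} ≤ 3/4`, so `(1 - x)^3 ≥ 1/64`
  have hhalf : (2 : ℝ) ^ (-(1 / 2 : ℝ)) ≤ 3 / 4 := by
    have h : ((2 : ℝ) ^ (-(1 / 2 : ℝ))) ^ 2 = 1 / 2 := by
      rw [← Real.rpow_natCast, ← Real.rpow_mul (by norm_num)]; norm_num
    nlinarith [Real.rpow_nonneg (show (0:ℝ) ≤ 2 by norm_num) (-(1 / 2 : ℝ))]
  have hloc : ∀ p ∈ Nat.primesBelow (D ^ 4), 0 ≤ u p ∧ u p ≤ 1280 * (1 + c) * B * (1 / p) := by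
    intro p hp
    have hpP := hprime p hp
    have hp2 : (2 : ℝ) ≤ p := by exact_mod_cast hpP.two_le
    have hp0 : (0 : ℝ) < p := by linarith
    set x : ℝ := (p : ℝ) ^ a with hx
    have hx0 : 0 ≤ x := Real.rpow_nonneg hp0.le _
    have hx34 : x ≤ 3 / 4 := by
      calc x ≤ (p : ℝ) ^ (-(1 / 2 : ℝ)) := Real.rpow_le_rpow_of_exponent_le (by linarith) ha
        _ ≤ (2 : ℝ) ^ (-(1 / 2 : ℝ)) := Real.rpow_le_rpow_of_nonpos (by norm_num) hp2 (by norm_num)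
        _ ≤ 3 / 4 := hhalf
    have hden : (1 / 64 : ℝ) ≤ (1 - x) ^ 3 := by
      have h : (1 / 4 : ℝ) ≤ 1 - x := by linarith
      calc (1 / 64 : ℝ) = (1 / 4) ^ 3 := by norm_num
        _ ≤ (1 - x) ^ 3 := pow_le_pow_left₀ (by norm_num) h 3
    have hdenpos : 0 < (1 - x) ^ 3 := by linarith
    obtain ⟨hw0, hw5⟩ := weight_nonneg_le hc hpP.two_le
    have hxB : x ≤ B / p := hpow p hp
    refine ⟨div_nonneg (by positivity) hdenpos.le, ?_⟩
    rw [hu]; simp only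
    rw [div_le_iff₀ hdenpos]
    calc 4 * ((1 + 8 / (p : ℝ)) * (1 + c * (p : ℝ) ^ (-(9 / 10 : ℝ)))) * x
        ≤ 4 * (5 * (1 + c)) * (B / p) := by gcongr
      _ = 1280 * (1 + c) * B * (1 / p) * (1 / 64) := by ring
      _ ≤ 1280 * (1 + c) * B * (1 / p) * (1 - x) ^ 3 := by
          apply mul_le_mul_of_nonneg_left hden (by positivity)
  have h1 : ∏ p ∈ Nat.primesBelow (D ^ 4), (1 + u p) ≤ Real.exp (∑ p ∈ Nat.primesBelow (D ^ 4), u p) :=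
    prod_one_add_le_exp_sum _ u fun p hp => (hloc p hp).1
  refine h1.trans (Real.exp_le_exp.mpr ?_)
  calc ∑ p ∈ Nat.primesBelow (D ^ 4), u p ≤ ∑ p ∈ Nat.primesBelow (D ^ 4), 1280 * (1 + c) * B * (1 / p) :=
        Finset.sum_le_sum fun p hp => (hloc p hp).2
    _ = 1280 * (1 + c) * B * ∑ p ∈ Nat.primesBelow (D ^ 4), (1 : ℝ) / p := by rw [Finset.mul_sum]
    _ ≤ 1280 * (1 + c) * B * (Real.log (4 * ell D) + 4) :=
        mul_le_mul_of_nonneg_left (sum_primesBelow_inv_le hD) (by positivity)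

end Evaluation

/-! ## 4. The pointwise majorant of `ϖ₁ⱼ` -/

section Pointwise

/-- `1 ≤ ∏_{i∈s} f i` when every factor is `≥ 1`. [folklore] -/
private theorem one_le_prod_of_one_le {ι : Type*} (s : Finset ι) (f : ι → ℝ)
    (h : ∀ i ∈ s, 1 ≤ f i) : 1 ≤ ∏ i ∈ s, f i :=
  Finset.prod_induction f (fun a => 1 ≤ a) (fun _ _ ha hb => one_le_mul_of_one_le_of_one_le ha hb)
    le_rfl h

/-- A product of factors `≥ 1` increases along `s ⊆ t`. [folklore] -/
private theorem prod_le_prod_of_subset_of_one_le_real {ι : Type*} [DecidableEq ι] {s t : Finset ι}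
    (hst : s ⊆ t) (f : ι → ℝ) (h : ∀ i ∈ t, 1 ≤ f i) : ∏ i ∈ s, f i ≤ ∏ i ∈ t, f i := by
  rw [← Finset.prod_sdiff hst]
  have h1 : 1 ≤ ∏ i ∈ t \ s, f i := one_le_prod_of_one_le _ f fun i hi => h i (Finset.sdiff_subset hi)
  have h0 : 0 ≤ ∏ i ∈ s, f i := Finset.prod_nonneg fun i hi => by linarith [h i (hst hi)]
  exact le_mul_of_one_le_left h0 h1

/-- **`|λ₁(d)| ≤ ∏_{q∣d}(1 + 8/q)`** (`λ₁(d) = ∏_{q∣d}λ₁(q)`, `|λ₁(q) − 1| ≤ 8/q`).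
[cite: Zhang2022LandauSiegel, §15 (15.10) p.82] -/
theorem norm_lam1_le_prod (c' : ℝ) {D : ℕ} (χ : DirichletCharacter ℂ D) (d : ℕ) :
    ‖Section15A.lam1 c' χ d 1‖ ≤ ∏ q ∈ d.primeFactors, (1 + 8 / (q : ℝ)) := by
  rw [Section15B.lam1_eq_prod_primeFactors]
  refine (Finset.norm_prod_le _ _).trans (Finset.prod_le_prod (fun q _ => norm_nonneg _) fun q hq => ?_)
  have hqP := Nat.prime_of_mem_primeFactors hq
  have h := Section15B.norm_lam1_prime_one_sub_one_le c' χ hqP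
  calc ‖Section15A.lam1 c' χ q 1‖ = ‖(Section15A.lam1 c' χ q 1 - 1) + 1‖ := by rw [sub_add_cancel]
    _ ≤ ‖Section15A.lam1 c' χ q 1 - 1‖ + ‖(1 : ℂ)‖ := norm_add_le _ _
    _ ≤ 8 / (q : ℝ) + 1 := by rw [norm_one]; linarith
    _ = 1 + 8 / (q : ℝ) := by ring

/-- `|∏_{q∈s}(1 + c·y_q)| ≤ ∏_{q∈s}(1 + |c|·y_q)` for `y_q ≥ 0`. [folklore] -/
private theorem abs_prod_one_add_mul_le {s : Finset ℕ} (c : ℝ) (y : ℕ → ℝ) (hy : ∀ q ∈ s, 0 ≤ y q) :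
    |∏ q ∈ s, (1 + c * y q)| ≤ ∏ q ∈ s, (1 + |c| * y q) := by
  rw [Finset.abs_prod]
  refine Finset.prod_le_prod (fun q _ => abs_nonneg _) fun q hq => ?_
  calc |1 + c * y q| ≤ |(1 : ℝ)| + |c * y q| := abs_add_le _ _
    _ = 1 + |c| * y q := by rw [abs_one, abs_mul, abs_of_nonneg (hy q hq)]

/-- **The pointwise majorant of `ϖ₁ⱼ`**: for all large `D`, under (A), for `1 ≤ j ≤ 3` and every
`n ≥ 1`, `|ϖ₁ⱼ(n)| ≤ K·τ₂(n)·∏_{q∣n}(1 + 8/q)(1 + c·q^{−9/10})` with absolute `K, c ≥ 0` (from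
`ϖ₁ⱼ(n) = Σ_{n=dl}λ₁(d)d^{βⱼ}χ(l)𝓜₁(d,l;1−βⱼ)/𝓜₁(1,1;1−βⱼ)`, §15.u035 `step15_u035_holds`,
`‖𝓜₁(1,1;1−βⱼ)‖ ≥ 1/2` `norm_calM1_one_one_betaJ_ge`, and `norm_lam1_le_prod`).
[cite: Zhang2022LandauSiegel, §15 pp.84–85] -/
theorem norm_varpi1_le_majorant (c' : ℝ) :
    ∃ K c : ℝ, 0 ≤ K ∧ 0 ≤ c ∧ ForAllLarge fun D _ χ => AssumptionA D χ →
      ∀ j ∈ ({1, 2, 3} : Finset ℕ), ∀ n : ℕ, 1 ≤ n →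
        ‖Section15B.varpi1 c' χ j n‖ ≤ K * (n.divisors.card : ℝ) *
          ∏ q ∈ n.primeFactors, (1 + 8 / (q : ℝ)) * (1 + c * (q : ℝ) ^ (-(9 / 10 : ℝ))) := by
  obtain ⟨c₅, C₅, h35⟩ := Section15B.step15_u035_holds c'
  refine ⟨2 * |C₅|, |c₅|, by positivity, abs_nonneg _, ?_⟩
  refine (h35.and (Section15B.norm_calM1_one_one_betaJ_ge c')).mono
    fun D _ χ _ _ h hA j hj n hn => ?_
  obtain ⟨h35D, hneD⟩ := h
  obtain ⟨-, hsre1, hnorm⟩ := hneD hA j hj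
  set s : ℂ := 1 - betaJ c' D j with hs
  have hsre : 9 / 10 < s.re := by rw [hsre1]; norm_num
  have hn0 : n ≠ 0 := by omega
  set W : ℝ := ∏ q ∈ n.primeFactors, (1 + 8 / (q : ℝ)) * (1 + |c₅| * (q : ℝ) ^ (-(9 / 10 : ℝ))) with hW
  -- the bound of one term of `ϖ₁ⱼ(n) = Σ_{n = dl} …`
  have hterm : ∀ x ∈ n.divisorsAntidiagonal,
      ‖Section15A.lam1 c' χ x.1 1 * (x.1 : ℂ) ^ betaJ c' D j * χ (x.2 : ZMod D) *
          (Section15B.calM1 c' χ x.1 x.2 s / Section15B.calM1 c' χ 1 1 s)‖ ≤ 2 * |C₅| * W := by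
    intro x hx
    have hx' := Nat.mem_divisorsAntidiagonal.mp hx
    have hx1 : 1 ≤ x.1 := Nat.pos_of_ne_zero fun h0 => hx'.2 (by rw [← hx'.1, h0, zero_mul])
    have hx2 : 1 ≤ x.2 := Nat.pos_of_ne_zero fun h0 => hx'.2 (by rw [← hx'.1, h0, mul_zero])
    -- the four factors
    have e1 : ‖Section15A.lam1 c' χ x.1 1‖ ≤ ∏ q ∈ n.primeFactors, (1 + 8 / (q : ℝ)) := by
      refine (norm_lam1_le_prod c' χ x.1).trans ?_
      refine prod_le_prod_of_subset_of_one_le_real (Nat.primeFactors_mono ⟨x.2, hx'.1.symm⟩ hn0) _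
        fun q hq => ?_
      have : (0 : ℝ) ≤ 8 / (q : ℝ) := by positivity
      linarith
    have e2 : ‖(x.1 : ℂ) ^ betaJ c' D j‖ = 1 := Section15B.norm_natCast_cpow_betaJ c' D j hx1
    have e3 : ‖χ (x.2 : ZMod D)‖ ≤ 1 := DirichletCharacter.norm_le_one χ _
    have e4 : ‖Section15B.calM1 c' χ x.1 x.2 s‖ ≤
        |C₅| * ∏ q ∈ n.primeFactors, (1 + |c₅| * (q : ℝ) ^ (-(9 / 10 : ℝ))) := by
      have h := h35D hA x.1 x.2 hx1 hx2 s hsre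
      rw [hx'.1] at h
      refine h.trans ((le_abs_self _).trans ?_)
      rw [abs_mul]
      exact mul_le_mul_of_nonneg_left
        (abs_prod_one_add_mul_le c₅ _ fun q _ => Real.rpow_nonneg (Nat.cast_nonneg q) _) (abs_nonneg _)
    have e5 : ‖Section15B.calM1 c' χ x.1 x.2 s / Section15B.calM1 c' χ 1 1 s‖ ≤
        2 * (|C₅| * ∏ q ∈ n.primeFactors, (1 + |c₅| * (q : ℝ) ^ (-(9 / 10 : ℝ)))) := by
      rw [norm_div]
      have hpos : 0 < ‖Section15B.calM1 c' χ 1 1 s‖ := by linarith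
      rw [div_le_iff₀ hpos]
      calc ‖Section15B.calM1 c' χ x.1 x.2 s‖
          ≤ |C₅| * ∏ q ∈ n.primeFactors, (1 + |c₅| * (q : ℝ) ^ (-(9 / 10 : ℝ))) := e4
        _ = 2 * (|C₅| * ∏ q ∈ n.primeFactors, (1 + |c₅| * (q : ℝ) ^ (-(9 / 10 : ℝ)))) * (1 / 2) := by
            ring
        _ ≤ 2 * (|C₅| * ∏ q ∈ n.primeFactors, (1 + |c₅| * (q : ℝ) ^ (-(9 / 10 : ℝ)))) *
            ‖Section15B.calM1 c' χ 1 1 s‖ := by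
            apply mul_le_mul_of_nonneg_left hnorm
            exact mul_nonneg (by norm_num) (mul_nonneg (abs_nonneg _)
              (Finset.prod_nonneg fun q _ => by positivity))
    have hW' : (∏ q ∈ n.primeFactors, (1 + 8 / (q : ℝ))) *
        (∏ q ∈ n.primeFactors, (1 + |c₅| * (q : ℝ) ^ (-(9 / 10 : ℝ)))) = W := by
      rw [hW, ← Finset.prod_mul_distrib]
    rw [norm_mul, norm_mul, norm_mul, e2, mul_one]
    have hP0 : 0 ≤ ∏ q ∈ n.primeFactors, (1 + 8 / (q : ℝ)) := Finset.prod_nonneg fun q _ => by positivity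
    calc ‖Section15A.lam1 c' χ x.1 1‖ * ‖χ (x.2 : ZMod D)‖ *
          ‖Section15B.calM1 c' χ x.1 x.2 s / Section15B.calM1 c' χ 1 1 s‖
        ≤ (∏ q ∈ n.primeFactors, (1 + 8 / (q : ℝ))) * 1 *
          (2 * (|C₅| * ∏ q ∈ n.primeFactors, (1 + |c₅| * (q : ℝ) ^ (-(9 / 10 : ℝ))))) := by
          refine mul_le_mul (mul_le_mul e1 e3 (norm_nonneg _) hP0) e5 (norm_nonneg _)
            (mul_nonneg hP0 zero_le_one)
      _ = 2 * |C₅| * W := by rw [← hW']; ring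
  unfold Section15B.varpi1
  calc ‖∑ x ∈ n.divisorsAntidiagonal, Section15A.lam1 c' χ x.1 1 * (x.1 : ℂ) ^ betaJ c' D j *
          χ (x.2 : ZMod D) * (Section15B.calM1 c' χ x.1 x.2 (1 - betaJ c' D j) /
            Section15B.calM1 c' χ 1 1 (1 - betaJ c' D j))‖
      ≤ ∑ x ∈ n.divisorsAntidiagonal, ‖Section15A.lam1 c' χ x.1 1 * (x.1 : ℂ) ^ betaJ c' D j *
          χ (x.2 : ZMod D) * (Section15B.calM1 c' χ x.1 x.2 (1 - betaJ c' D j) /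
            Section15B.calM1 c' χ 1 1 (1 - betaJ c' D j))‖ := norm_sum_le _ _
    _ ≤ ∑ x ∈ n.divisorsAntidiagonal, 2 * |C₅| * W := Finset.sum_le_sum hterm
    _ = (n.divisorsAntidiagonal.card : ℝ) * (2 * |C₅| * W) := by rw [Finset.sum_const, nsmul_eq_mul]
    _ = 2 * |C₅| * (n.divisors.card : ℝ) * W := by
        rw [← Nat.map_div_right_divisors, Finset.card_map]; ring

end Pointwise

/-! ## 5. The smooth majorant (hypothesis `hS` of the (15.22) deduction) -/

section Smooth

/-- `1 ≤ 𝓛` in `ForAllLarge` form. [cite: Zhang2022LandauSiegel, §2 p.4] -/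
private theorem forAllLarge_one_le_ell : ForAllLarge fun D _ _ => 2 ≤ D ∧ 1 ≤ ell D := by
  obtain ⟨D₁, hD₁⟩ := exists_nat_forall_le_ell 1
  exact ForAllLarge.of_le (max D₁ 2) fun D _ _ hD _ _ =>
    ⟨le_trans (le_max_right _ _) hD, hD₁ D (le_trans (le_max_left _ _) hD)⟩

open scoped Classical in
/-- **The smooth majorant — hypothesis `hS` of `calS1_eval_of_parts`, DISCHARGED**: for all large `D`,
under (A), for `1 ≤ j ≤ 3`, `Σ_{n∈𝒩(𝒬), n<T} τ₂(n)|ϖ₁ⱼ(n)|/n ≤ C𝓛⁶` (indeed `≤ C′𝓛⁴`: the sum is at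
most `K Σ_{n∈𝒩(𝒬)} τ₂(n)²∏_{q∣n}w(q)/n ≤ K∏_{p<D⁴}(1 + 4w(p)p⁻¹/(1−p⁻¹)³) ≤ 256K e^{16+KZ}𝓛⁴` by
`sum_majorant_le_prod` and `prod_local_factor_zero_le`). [cite: Zhang2022LandauSiegel, §15 p.87] -/
theorem smooth_majorant_holds (c' : ℝ) :
    ∃ C : ℝ, ForAllLarge fun D _ χ => AssumptionA D χ → ∀ j ∈ ({1, 2, 3} : Finset ℕ),
      ∑ n ∈ (Finset.Ico 1 ⌈bigT D⌉₊).filter (fun n => n ∈ nset (frakq D)),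
        (n.divisors.card : ℝ) * ‖Section15B.varpi1 c' χ j n‖ / n ≤ C * ell D ^ 6 := by
  obtain ⟨K, c, hK, hc, hϖ⟩ := norm_varpi1_le_majorant c'
  set Z : ℝ := ∑' n : ℕ, (n : ℝ) ^ (-(19 / 10 : ℝ)) with hZ
  refine ⟨K * (256 * Real.exp (16 + 32 * (11 + 9 * c) * Z)), ?_⟩
  refine (hϖ.and forAllLarge_one_le_ell).mono fun D _ χ _ _ h hA j hj => ?_
  obtain ⟨hϖD, hD2, hℓ1⟩ := h
  set w : ℕ → ℝ := fun q => (1 + 8 / (q : ℝ)) * (1 + c * (q : ℝ) ^ (-(9 / 10 : ℝ))) with hw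
  have hw0 : ∀ q, 0 ≤ w q := by
    intro q
    rcases Nat.lt_or_ge q 2 with hq | hq
    · interval_cases q <;> (simp only [hw]; positivity)
    · exact (weight_nonneg_le hc hq).1
  set A := (Finset.Ico 1 ⌈bigT D⌉₊).filter (fun n => n ∈ nset (frakq D)) with hAdef
  -- termwise domination by `K·F(n)`, `F(n) = τ₂(n)²(∏ w)·n⁻¹`
  have hdom : ∀ n ∈ A, (n.divisors.card : ℝ) * ‖Section15B.varpi1 c' χ j n‖ / n ≤
      K * (((n.divisors.card : ℝ)) ^ 2 * (∏ q ∈ n.primeFactors, w q) * (n : ℝ) ^ (-(1 : ℝ))) := by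
    intro n hn
    have hn1 : 1 ≤ n := (Finset.mem_Ico.mp (Finset.mem_filter.mp hn).1).1
    have hn0 : (0 : ℝ) < n := by exact_mod_cast hn1
    have h := hϖD hA j hj n hn1
    rw [Real.rpow_neg_one, div_eq_mul_inv]
    have hτ : (0 : ℝ) ≤ n.divisors.card := Nat.cast_nonneg _
    calc (n.divisors.card : ℝ) * ‖Section15B.varpi1 c' χ j n‖ * (n : ℝ)⁻¹
        ≤ (n.divisors.card : ℝ) * (K * (n.divisors.card : ℝ) * ∏ q ∈ n.primeFactors, w q) * (n : ℝ)⁻¹ := by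
          gcongr
      _ = K * (((n.divisors.card : ℝ)) ^ 2 * (∏ q ∈ n.primeFactors, w q) * (n : ℝ)⁻¹) := by ring
  have hA : ∀ n ∈ A, n ∈ Nat.factoredNumbers (Nat.primesBelow (D ^ 4)) :=
    fun n hn => mem_factoredNumbers_of_mem_nset_frakq (Finset.mem_filter.mp hn).2
  have hprime : ∀ p ∈ Nat.primesBelow (D ^ 4), p.Prime := fun p hp => (Nat.mem_primesBelow.mp hp).2
  have hmaj := sum_majorant_le_prod hw0 (show (-(1 : ℝ)) ≤ -(1 / 2 : ℝ) by norm_num)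
    (Nat.primesBelow (D ^ 4)) hprime A hA
  have hprod := prod_local_factor_zero_le hc hD2
  have hℓ46 : ell D ^ 4 ≤ ell D ^ 6 := pow_le_pow_right₀ hℓ1 (by norm_num)
  calc ∑ n ∈ A, (n.divisors.card : ℝ) * ‖Section15B.varpi1 c' χ j n‖ / n
      ≤ ∑ n ∈ A, K * (((n.divisors.card : ℝ)) ^ 2 * (∏ q ∈ n.primeFactors, w q) * (n : ℝ) ^ (-(1 : ℝ))) :=
        Finset.sum_le_sum hdom
    _ = K * ∑ n ∈ A, ((n.divisors.card : ℝ)) ^ 2 * (∏ q ∈ n.primeFactors, w q) * (n : ℝ) ^ (-(1 : ℝ)) := by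
        rw [Finset.mul_sum]
    _ ≤ K * ∏ p ∈ Nat.primesBelow (D ^ 4), (1 + 4 * w p * (p : ℝ) ^ (-(1 : ℝ)) / (1 - (p : ℝ) ^ (-(1 : ℝ))) ^ 3) :=
        mul_le_mul_of_nonneg_left hmaj hK
    _ ≤ K * (256 * Real.exp (16 + 32 * (11 + 9 * c) * Z) * ell D ^ 4) :=
        mul_le_mul_of_nonneg_left hprod hK
    _ ≤ K * (256 * Real.exp (16 + 32 * (11 + 9 * c) * Z) * ell D ^ 6) := by gcongr
    _ = K * (256 * Real.exp (16 + 32 * (11 + 9 * c) * Z)) * ell D ^ 6 := by ring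

end Smooth

end Literature.NumberTheory.LFunctions.Zhang2022.Typed.Section15C
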